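import Literature.AlgebraicGeometry.Resolution.AbhyankarRationalUniformization
import Mathlib.RingTheory.Etale.StandardEtale
import Mathlib.FieldTheory.Minpoly.IsIntegrallyClosed
import Mathlib.RingTheory.Polynomial.Subring
import Mathlib.RingTheory.IntegralClosure.IntegrallyClosed
import Mathlib.RingTheory.Polynomial.UniqueFactorization
import HarnessLib

/-!
# Knaf–Kuhlmann 2005, §5: étale ascent — Thm. 1.1 from Thm. 3.4

Topic: `Literature/AlgebraicGeometry/Resolution`. Second leg of the decomposition of the named
fact `KnafKuhlmann2005_Thm11` (Knaf–Kuhlmann 2005, Thm. 1.1; `FiniteExtensionUniformization.lean`),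
continuing `AbhyankarRationalUniformization.lean` (§4). Knaf–Kuhlmann's proof of Thm. 1.1
(§5, pp. 12–13): by Thm. 3.4 the function field `F` lies in the absolute inertia field of
`E := K(T)` for an Abhyankar transcendence basis `T = (x, y)`, so that `O_F` is the local ring
at the centre of a standard-étale `O_E`-algebra `O_E[X]_g/(f)` ([Ray] X Thm. 1, V Thm. 1);
Lemma 5.1 then ascends `K`-uniformizability from `(P|E, Z'')` — settled by Thm. 4.1 — to
`(P, Z)` along this étale extension.

* `KnafKuhlmann2005_Thm34_etale` — NAMED FACT: Knaf–Kuhlmann 2005, Thm. 3.4 (whose proof rests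
  on the Generalized Stability Theorem, Thm. 3.1 = [K1], and Hensel's Lemma) for a `K`-trivial
  place, in the standard-étale form in which §5 (p. 12) uses it: Abhyankar elements `x, y`,
  `η ∈ O_F` with `F = E(η)`, a monic `f` over `O_E` of least degree with `f(η) = 0`,
  `f'h + f p₂ = gˢ` over `O_E` with `g(η) ∈ O_F^×`, and `O_F = (O_E[η]_{g(η)})_q`.
* `exists_smooth_normal_locAway` — PROVED (folklore): a smooth normal model `A₀ ⊆ O_V ∩ E`
  localised at a suitable `d` with `v(d) = 0` contains finitely many given elements of its
  local ring and stays smooth and normal.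
* `exists_standardEtale_model` — PROVED, the heart of Lemma 5.1 for `R = K`: for
  `B ⊆ O_V ∩ F` smooth over `K` and normal, `η ∈ O_V ∩ F` with monic minimal equation `f` over
  `B` and `f'h + f p₂ = gˢ`, `v(g(η)) = 0`, the `B`-algebra `B[η]_{g(η)} ⊆ O_V ∩ F` is standard
  étale over `B` (`B[η] ≅ B[X]/(f)` as `f = minpoly_B(η)`, `B` integrally closed — Mathlib's
  `minpoly.isIntegrallyClosed_dvd` —; Mathlib's `StandardEtalePair`), hence finitely presented
  and smooth over `K`.
* `KnafKuhlmann2005_Thm11.of_parts` — PROVED: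
  `KnafKuhlmann2005_Thm34_etale → KnafKuhlmann2005_Thm11` (Lemma 5.1 with `R = K` and the
  assembly of p. 13, Thm. 4.1 being `knafKuhlmann2005_thm41_field` and Lemma 4.2 the tree's
  `PerronTransforms.lean`: `Z'' :=` the coefficients of `f, g, h, p₂` and of the representations
  `ζ = a(η)/(b(η)g(η)ᵏ)` of the `ζ ∈ Z`; `B := K[x', y][1/d] ⊇ Z''` by Thm. 4.1;
  `C := B[η]_{g(η)}`; `Frac C = F`, `Z ⊆ C_q`).
* `KnafKuhlmann2009_Thm12.of_parts''`, `KnafKuhlmann2009.of_parts''` — PROVED corollaries: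
  Knaf–Kuhlmann 2009, Thm. 1.2 and the fact `KnafKuhlmann2009` from the two named facts
  `KnafKuhlmann2009_Thm11` (KK09 Thm. 1.1: henselian rationality) and
  `KnafKuhlmann2005_Thm34_etale` (Generalized Stability Theorem, inertial generation).

## Sources

* H. Knaf, F.-V. Kuhlmann, *Abhyankar places admit local uniformization in any
  characteristic*, Ann. Sci. ÉNS 38 (2005) 833–846 = arXiv:math/0304159: Thm. 3.4 (p. 7),
  §5: the standard-étale setup and the Claim (p. 12), Lemma 5.1 (pp. 12–13), proof of Thm. 1.1
  (p. 13). Pages refer to the arXiv PDF.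
* M. Raynaud, *Anneaux locaux henséliens*, LNM 169 (1970), Ch. V Thm. 1 and Ch. X Thm. 1 (as
  cited by Knaf–Kuhlmann, p. 12).
* Standard étale algebras: Mathlib (`Mathlib.RingTheory.Etale.StandardEtale`).
-/

noncomputable section

namespace Literature.AlgebraicGeometry.Resolution

universe u

open IsLocalRing Polynomial

/-- NAMED FACT — **Knaf–Kuhlmann 2005, Thm. 3.4, in the standard-étale form of §5** (Thm. 3.4:
"Assume that `(F|K,P)` is a valued function field without transcendence defect [i.e. `P` is an
Abhyankar place] such that `FP|KP` is separable. … `(K,P)` is a defectless field and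
`v_P F/v_P K` is torsion-free. Then `(F|K,P)` is inertially generated, by which we mean that
there is a transcendence basis `T = {x₁,…,x_ρ,y₁,…,y_τ}` such that a) `v_P F = v_P K ⊕ ℤv_P x₁ ⊕
… ⊕ ℤv_P x_ρ`, b) `y₁P,…,y_τP` form a separating transcendence basis of `FP|KP`, c) `(F,P)`
lies in the absolute inertia field of `(K(T),P)`"; §5, p. 12: "Consider a finite extension
`(F|E,P)` of valued fields such that `F` is contained in the absolute inertia field of
`(E,P|_E)`. It is then well-known that the extension `O_F|O_E` is local-étale ([Ray], Ch. X,
Thm. 1): `O_F = A_q` for an étale `O_E`-algebra `A` and `q = A ∩ M_F`. According to [Ray],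
Ch. V, Thm. 1 we can assume that `A` is standard-étale, i.e. `A = O_E[x]_{g(x)}`, where
`O_E[x] = O_E[X]/fO_E[X]` with a monic polynomial `f ∈ O_E[X]`. Furthermore, `g ∈ O_E[X]` is
chosen such that the image of the derivative `f'` under the natural morphism `φ : O_E[X] → A`
is a unit. Claim: In the definition of `A` we can assume `f` to be prime."). Vendored for a
`K`-TRIVIAL place (`K ⊆ O_P`; then `(K, P)` is defectless and `v_P F/v_P K = v_P F` is
torsion-free, so Thm. 3.4 applies to an Abhyankar place with `FP|KP` separable), as the
conjunction of what §5 uses, for `E := K(T) = K(x, y)`: elements `xᵢ ∈ F^×` with `ℤ`-independent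
values and `yⱼ ∈ O_P ∩ F` with residues algebraically independent over `KP` (consequences of
a), b)); an element `η ∈ O_F` (the `x` of p. 12) with `F = E(η)` (`Frac A = F`); a monic
`f` over `O_E` with `f(η) = 0`, of least degree among the non-zero polynomials over `E`
vanishing at `η` (`f` prime); `g, h, p₂` over `O_E` and `s` with `f'h + f p₂ = gˢ` (`φ(f')` is a
unit of `A = O_E[X]_g/(f)`) and `g(η)` a unit of `O_F` (`A ⊆ O_F`); and `O_F = A_q`: every
`z ∈ O_F` is `a(η) / (b(η) g(η)ᵏ)` with `a, b` over `O_E` and `b(η)` a unit of `O_F`. The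
separating clause of b) and the absolute inertia field itself are not rendered. Users take
`(h : KnafKuhlmann2005_Thm34_etale)`.
[cite: KnafKuhlmann2005, Thm. 3.4 and Section 5 (p. 12)] -/
def KnafKuhlmann2005_Thm34_etale : Prop :=
  ∀ (Ω : Type u) [Field Ω] (V : ValuationSubring Ω) (K F : Subfield Ω),
    K ≤ F → FGOver K F → (K : Set Ω) ⊆ V → IsAbhyankarPlace V K F →
    SeparablyGeneratedOver (resField V K) (resField V F) →
    ∃ (ρ τ : ℕ) (x : Fin ρ → Ω) (y : Fin τ → Ω) (hy : ∀ j, y j ∈ V),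
      (∀ i, x i ∈ F ∧ x i ≠ 0) ∧ (∀ j, y j ∈ F) ∧
      (∀ m : Fin ρ → ℤ, (∃ b ∈ K, (∏ i, V.valuation (x i) ^ (m i)) = V.valuation b) → m = 0) ∧
      AlgebraicIndependent (resField V K) (fun j => residue V ⟨y j, hy j⟩) ∧
      ∃ (η : Ω) (f g h p₂ : Polynomial Ω) (s : ℕ),
        η ∈ V ∧
        Subfield.closure ((Subfield.closure ((K : Set Ω) ∪ (Set.range x ∪ Set.range y)) : Set Ω)
          ∪ {η}) = F ∧
        f.Monic ∧ f.eval η = 0 ∧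
        (∀ P ∈ ({f, g, h, p₂} : Set (Polynomial Ω)), ∀ k, P.coeff k ∈ V ∧
          P.coeff k ∈ Subfield.closure ((K : Set Ω) ∪ (Set.range x ∪ Set.range y))) ∧
        (∀ P : Polynomial Ω,
          (∀ k, P.coeff k ∈ Subfield.closure ((K : Set Ω) ∪ (Set.range x ∪ Set.range y))) →
          P ≠ 0 → P.eval η = 0 → f.natDegree ≤ P.natDegree) ∧
        Polynomial.derivative f * h + f * p₂ = g ^ s ∧
        V.valuation (g.eval η) = 1 ∧
        ∀ z ∈ F, z ∈ V → ∃ (a b : Polynomial Ω) (k : ℕ),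
          (∀ P ∈ ({a, b} : Set (Polynomial Ω)), ∀ k, P.coeff k ∈ V ∧
            P.coeff k ∈ Subfield.closure ((K : Set Ω) ∪ (Set.range x ∪ Set.range y))) ∧
          V.valuation (b.eval η) = 1 ∧ z = a.eval η / (b.eval η * g.eval η ^ k)

variable {Ω : Type u} [Field Ω]

/-! ## Polynomials over `Ω` with coefficients in a subalgebra -/

section PolyLift

variable {K : Subfield Ω} (B : Subalgebra K Ω)

/-- A polynomial over `Ω` all of whose coefficients lie in the subalgebra `B` is the image of a
polynomial over `B`; a monic one of a monic one. [folklore] -/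
theorem exists_map_eq_of_coeff_mem (P : Polynomial Ω) (hP : ∀ k, P.coeff k ∈ B) :
    ∃ Q : Polynomial B, Q.map (algebraMap B Ω) = P ∧ (P.Monic → Q.Monic) := by
  have hl : P ∈ Polynomial.lifts (algebraMap B Ω) :=
    (Polynomial.lifts_iff_coeff_lifts P).mpr fun k => ⟨⟨P.coeff k, hP k⟩, rfl⟩
  by_cases hmon : P.Monic
  · obtain ⟨Q, hQ, -, hQm⟩ := Polynomial.lifts_and_degree_eq_and_monic hl hmon
    exact ⟨Q, hQ, fun _ => hQm⟩
  · obtain ⟨Q, hQ⟩ := (Polynomial.mem_lifts P).mp hl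
    exact ⟨Q, hQ, fun h => (hmon h).elim⟩

/-- `aeval η Q = (Q.map (B → Ω)).eval η`. [folklore] -/
theorem aeval_eq_eval_map (Q : Polynomial B) (η : Ω) :
    Polynomial.aeval η Q = (Q.map (algebraMap B Ω)).eval η := by
  rw [Polynomial.aeval_def, Polynomial.eval_map]

end PolyLift

/-- Evaluating a polynomial with coefficients in a subring `W ∋ η` at `η` stays in `W`.
[folklore] -/
theorem eval_mem_of_coeff_mem {S : Type*} [SetLike S Ω] [SubringClass S Ω] (W : S)
    (P : Polynomial Ω) (hP : ∀ k, P.coeff k ∈ W) {η : Ω} (hη : η ∈ W) : P.eval η ∈ W := by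
  rw [Polynomial.eval_eq_sum_range]
  exact sum_mem fun k _ => mul_mem (hP k) (pow_mem hη k)

/-! ## Knaf–Kuhlmann 2005, Lemma 5.1 (`R = K`) and Thm. 1.1 from Thm. 3.4 -/

section EtaleAscent

variable (V : ValuationSubring Ω) {K : Subfield Ω}

/-- **Enlarging a smooth normal model to contain finitely many elements of its local ring**:
if `A₀ ⊆ O_V ∩ E` is smooth over `K` and normal and the elements of `Z''` are quotients `a/b`,
`a, b ∈ A₀`, `v(b) = 0`, then `B := A₀[1/d]`, `d` the product of the denominators, contains
`Z''` and is again smooth over `K`, normal, and inside `O_V ∩ E`. [folklore] -/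
theorem exists_smooth_normal_locAway (A₀ : Subalgebra K Ω) [Algebra.FinitePresentation K A₀]
    [Algebra.FormallySmooth K A₀] [IsIntegrallyClosed A₀] (hA₀V : A₀.toSubring ≤ V.toSubring)
    {E : Subfield Ω} (hA₀E : (A₀ : Set Ω) ⊆ E) (Z'' : Finset Ω)
    (hZ'' : ∀ w ∈ Z'', ∃ a ∈ A₀, ∃ b ∈ A₀, V.valuation b = 1 ∧ w = a / b) :
    ∃ B : Subalgebra K Ω, A₀ ≤ B ∧ B.toSubring ≤ V.toSubring ∧ (B : Set Ω) ⊆ E ∧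
      (∀ w ∈ Z'', w ∈ B) ∧ Algebra.Smooth K B ∧ IsIntegrallyClosed B := by
  classical
  choose num hnum den hden hvden hweq using hZ''
  let d : Ω := ∏ w ∈ Z''.attach, den w w.2
  have hdA : d ∈ A₀ := prod_mem fun w _ => hden w w.2
  have hvd : V.valuation d = 1 := by
    simp only [d, map_prod]
    exact Finset.prod_eq_one fun w _ => hvden w w.2
  have hd0 : d ≠ 0 := fun h0 => by
    rw [h0, map_zero] at hvd
    exact zero_ne_one hvd
  let B : Subalgebra K Ω := locAway A₀ d hdA
  have hA₀B : A₀ ≤ B := le_locAway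
  have hZ''B : ∀ w ∈ Z'', w ∈ B := by
    intro w hw
    have hden0 : den w hw ≠ 0 := fun h0 => by
      have := hvden w hw
      rw [h0, map_zero] at this
      exact zero_ne_one this
    have hsplit : d = den w hw * ∏ w' ∈ (Z''.attach.erase ⟨w, hw⟩), den w' w'.2 :=
      (Finset.mul_prod_erase Z''.attach (fun w' : {w' // w' ∈ Z''} => den w' w'.2)
        (Finset.mem_attach _ ⟨w, hw⟩)).symm
    have hwden : w * den w hw = num w hw := (eq_div_iff hden0).mp (hweq w hw)
    refine ⟨1, ?_⟩
    rw [pow_one, hsplit, ← mul_assoc, hwden]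
    exact mul_mem (hnum w hw) (prod_mem fun w' _ => hden w' w'.2)
  letI algB : Algebra A₀ B := (Subalgebra.inclusion hA₀B).toRingHom.toAlgebra
  haveI : IsScalarTower K A₀ B := IsScalarTower.of_algebraMap_eq fun _ => rfl
  haveI hloc : IsLocalization.Away (⟨d, hdA⟩ : A₀) B := isLocalization_locAway hd0
  haveI : Algebra.Smooth K A₀ := {}
  have hBsm : Algebra.Smooth K B := by
    haveI : Algebra.Smooth A₀ B := Algebra.Smooth.of_isLocalization_Away (⟨d, hdA⟩ : A₀)
    exact Algebra.Smooth.comp K A₀ B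
  have hBic : IsIntegrallyClosed B :=
    isIntegrallyClosed_of_isLocalization B (Submonoid.powers (⟨d, hdA⟩ : A₀))
      (powers_le_nonZeroDivisors_of_noZeroDivisors fun h0 => hd0 (congrArg Subtype.val h0))
  exact ⟨B, hA₀B, locAway_le_valuationSubring hA₀V hvd, locAway_subset_subfield hA₀E hd0, hZ''B,
    hBsm, hBic⟩

/-- **The standard-étale model** (heart of Knaf–Kuhlmann 2005, Lemma 5.1, case `R = K`): let
`B ⊆ O_V ∩ F` be smooth over `K` and normal, `η ∈ O_V ∩ F`, `f ∈ B[X]` monic with `f(η) = 0`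
and of least degree among the non-zero polynomials over `B` vanishing at `η`, and
`f'h + f p₂ = gˢ` in `B[X]` with `g(η)` a unit of `O_V`. Then `f` is the minimal polynomial of
`η` over the integrally closed `B`, so `B[η] ≅ B[X]/(f)` and `A := B[η]_{g(η)} ≅ (B[X]/(f))_g`
is standard étale over `B`; hence `A ⊆ O_V ∩ F` is finitely presented and smooth over `K`
(at every prime). [cite: KnafKuhlmann2005, Lemma 5.1 (proof, pp. 12–13)] -/
theorem exists_standardEtale_model (B : Subalgebra K Ω) [Algebra.Smooth K B]
    [IsIntegrallyClosed B] (hBV : B.toSubring ≤ V.toSubring) {F : Subfield Ω}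
    (hBF : (B : Set Ω) ⊆ F) {η : Ω} (hηV : η ∈ V) (hηF : η ∈ F)
    (fB gB hB p₂B : Polynomial B) (s : ℕ) (hfBmon : fB.Monic) (hfBη : Polynomial.aeval η fB = 0)
    (hfBmin : ∀ q : Polynomial B, q ≠ 0 → Polynomial.aeval η q = 0 → fB.natDegree ≤ q.natDegree)
    (hidentB : Polynomial.derivative fB * hB + fB * p₂B = gB ^ s)
    (hvg : V.valuation (Polynomial.aeval η gB) = 1) :
    ∃ (A : Subalgebra K Ω) (hAV : A.toSubring ≤ V.toSubring), (A : Set Ω) ⊆ F ∧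
      Algebra.FinitePresentation K A ∧ Algebra.IsSmoothAt K (centre A V hAV) ∧
      ∀ q : Polynomial B, Polynomial.aeval η q ∈ A := by
  classical
  have hgη0 : Polynomial.aeval η gB ≠ 0 := fun h0 => by
    rw [h0, map_zero] at hvg
    exact zero_ne_one hvg
  have hinj : Function.Injective (algebraMap B Ω) := Subtype.val_injective
  -- `fB` is the minimal polynomial of `η` over `B`
  have hint : IsIntegral B η := ⟨fB, hfBmon, by rw [← Polynomial.aeval_def]; exact hfBη⟩
  have hmin : fB = minpoly B η := by
    refine minpoly.unique' B η hfBmon hfBη fun q hq => ?_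
    by_cases hq0 : q = 0
    · exact Or.inl hq0
    · refine Or.inr fun hq' => ?_
      exact absurd (Polynomial.natDegree_lt_natDegree hq0 hq) (not_lt.mpr (hfBmin q hq0 hq'))
  -- `φ₀ : B[X]/(f) → Ω`, `X ↦ η`, is injective
  let φ₀ : AdjoinRoot fB →ₐ[B] Ω := AdjoinRoot.liftAlgHom fB (Algebra.ofId B Ω) η
    (by rw [Algebra.toRingHom_ofId, ← Polynomial.aeval_def]; exact hfBη)
  have hφ₀mk : ∀ q : Polynomial B, φ₀ (AdjoinRoot.mk fB q) = Polynomial.aeval η q := fun q => by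
    simp only [φ₀, AdjoinRoot.liftAlgHom_mk, Polynomial.aeval_def, Algebra.toRingHom_ofId]
  have hφ₀ : Function.Injective φ₀ := by
    rw [injective_iff_map_eq_zero]
    intro p hp
    obtain ⟨q, rfl⟩ := AdjoinRoot.mk_surjective p
    rw [hφ₀mk] at hp
    rw [AdjoinRoot.mk_eq_zero, hmin]
    exact minpoly.isIntegrallyClosed_dvd hint hp
  -- the standard-étale algebra `L = (B[X]/(f))[1/g]` and `ψ : L → Ω`
  set r : AdjoinRoot fB := AdjoinRoot.mk fB gB with hr
  have hφ₀r : φ₀ r = Polynomial.aeval η gB := by rw [hr, hφ₀mk]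
  have hrunit : IsUnit (φ₀ r) := by rw [hφ₀r]; exact isUnit_iff_ne_zero.mpr hgη0
  let L := Localization.Away r
  let ψ : L →ₐ[B] Ω := IsLocalization.Away.liftAlgHom r (f := φ₀) hrunit
  have hψalg : ∀ a : AdjoinRoot fB, ψ (algebraMap (AdjoinRoot fB) L a) = φ₀ a := fun a => by
    simp only [ψ, IsLocalization.Away.coe_liftAlgHom, IsLocalization.Away.lift_eq]
    rfl
  have hnf : ∀ l : L, ∃ (q : Polynomial B) (n : ℕ),
      ψ l = Polynomial.aeval η q / Polynomial.aeval η gB ^ n := by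
    intro l
    obtain ⟨⟨a, m⟩, hlm⟩ := IsLocalization.surj (Submonoid.powers r) l
    obtain ⟨n, hn⟩ := (Submonoid.mem_powers_iff _ _).mp m.2
    obtain ⟨q, rfl⟩ := AdjoinRoot.mk_surjective a
    refine ⟨q, n, ?_⟩
    have h1 : ψ l * Polynomial.aeval η gB ^ n = Polynomial.aeval η q := by
      have := congrArg ψ hlm
      rw [map_mul, hψalg, hψalg, hφ₀mk] at this
      rw [← this, ← hn, map_pow, hφ₀r]
    rw [← h1, mul_div_assoc, div_self (pow_ne_zero n hgη0), mul_one]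
  have hψ : Function.Injective ψ := by
    rw [injective_iff_map_eq_zero]
    intro l hl
    obtain ⟨⟨a, m⟩, hlm⟩ := IsLocalization.surj (Submonoid.powers r) l
    have h1 : φ₀ a = 0 := by
      have := congrArg ψ hlm
      rw [map_mul, hψalg, hψalg, hl, zero_mul] at this
      exact this.symm
    have ha : a = 0 := hφ₀ (by rw [h1, map_zero])
    rw [ha, map_zero] at hlm
    exact (IsLocalization.map_units L m).mul_left_eq_zero.mp hlm
  -- `L` is standard étale over `B`, hence smooth over `K`; so is its image `A = ψ(L) ⊆ Ω`
  let SE : StandardEtalePair B :=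
    { f := fB, monic_f := hfBmon, g := gB, cond := ⟨hB, p₂B, s, hidentB⟩ }
  haveI : Algebra.IsStandardEtale B L := Algebra.IsStandardEtale.of_equiv SE.equivAwayAdjoinRoot
  haveI : Algebra.Etale B L := inferInstance
  haveI hfsL : Algebra.FormallySmooth K L := Algebra.FormallySmooth.comp K B L
  haveI hfpL : Algebra.FinitePresentation K L := Algebra.FinitePresentation.trans K B L
  let ψK : L →ₐ[K] Ω := ψ.restrictScalars K
  have hψK : Function.Injective ψK := hψ
  set A : Subalgebra K Ω := ψK.range with hA
  let eA : L ≃ₐ[K] A := AlgEquiv.ofInjective ψK hψK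
  have hfpA : Algebra.FinitePresentation K A := Algebra.FinitePresentation.equiv eA
  haveI hfsA : Algebra.FormallySmooth K A := Algebra.FormallySmooth.of_equiv eA
  -- membership facts for `A`
  have hmemA : ∀ w : Ω, w ∈ A ↔ ∃ l, ψ l = w := fun w => AlgHom.mem_range ψK
  have hpolyA : ∀ q : Polynomial B, Polynomial.aeval η q ∈ A := fun q =>
    (hmemA _).mpr ⟨algebraMap _ L (AdjoinRoot.mk fB q), by rw [hψalg, hφ₀mk]⟩
  have hnumV : ∀ q : Polynomial B, Polynomial.aeval η q ∈ V := fun q => by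
    rw [aeval_eq_eval_map]
    exact eval_mem_of_coeff_mem V _
      (fun k => by rw [Polynomial.coeff_map]; exact hBV (q.coeff k).2) hηV
  have hnumF : ∀ q : Polynomial B, Polynomial.aeval η q ∈ F := fun q => by
    rw [aeval_eq_eval_map]
    exact eval_mem_of_coeff_mem F _
      (fun k => by rw [Polynomial.coeff_map]; exact hBF (q.coeff k).2) hηF
  have hgpowV : ∀ n : ℕ, (Polynomial.aeval η gB ^ n)⁻¹ ∈ V := fun n =>
    (V.valuation_le_one_iff _).mp (by rw [map_inv₀, map_pow, hvg, one_pow, inv_one])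
  have hAV : A.toSubring ≤ V.toSubring := by
    intro w hw
    obtain ⟨l, rfl⟩ := (hmemA w).mp hw
    obtain ⟨q, n, hq⟩ := hnf l
    rw [hq, div_eq_mul_inv]
    exact mul_mem (hnumV q) (hgpowV n)
  have hAF : (A : Set Ω) ⊆ F := by
    intro w hw
    obtain ⟨l, rfl⟩ := (hmemA w).mp hw
    obtain ⟨q, n, hq⟩ := hnf l
    rw [hq]
    exact div_mem (hnumF q) (pow_mem (hnumF gB) n)
  exact ⟨A, hAV, hAF, hfpA, isSmoothAt_of_formallySmooth _, hpolyA⟩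

/-- **Knaf–Kuhlmann 2005, Thm. 1.1 from Thm. 3.4** (the proof of §5: Lemma 5.1
for `R = K` and the final assembly on p. 13). Given the data of `KnafKuhlmann2005_Thm34_etale`
for `(F|K, P)` and a finite `Z ⊆ O_F`: let `Z'' ⊆ O_E` be the set of coefficients of
`f, g, h, p₂` and of the `a, b` representing the elements of `Z`; by Thm. 4.1 (`R = K`,
`knafKuhlmann2005_thm41_field`) there is a polynomial ring `K[x', y] ⊆ O_E` with `Z''` in its
local ring at the centre, hence in `B := K[x', y][1/d] ⊆ O_E` for a suitable `d` with
`v(d) = 0` (`exists_smooth_normal_locAway`); `B` is smooth over `K` and normal with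
`Frac B = E`. By `exists_standardEtale_model`, `C := B[η]_{g(η)}` is a standard-étale
`B`-algebra inside `O_F`, finitely presented and smooth over `K`, with `Frac C = F`, and every
`ζ = a(η)/(b(η)g(η)ᵏ) ∈ Z` lies in `C_q`. [cite: KnafKuhlmann2005, Lemma 5.1 and proof of
Thm. 1.1 (pp. 12–13)] -/
theorem KnafKuhlmann2005_Thm11.of_parts (h34 : KnafKuhlmann2005_Thm34_etale.{u}) :
    KnafKuhlmann2005_Thm11.{u} := by
  intro Ω _ V K F hKF hfg hKV hAbh hsep Z hZ
  classical
  obtain ⟨ρ, τ, x, y, hy, hxF, hyF, hxi, hri, η, f, g, h, p₂, s, hηV, hEηF, hfmon, hfη, hcoef,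
    hfmin, hident, hvg, hOF⟩ := h34 Ω V K F hKF hfg hKV hAbh hsep
  set E : Subfield Ω := Subfield.closure ((K : Set Ω) ∪ (Set.range x ∪ Set.range y)) with hE
  have hx0 : ∀ i, x i ≠ 0 := fun i => (hxF i).2
  have hKV' : ∀ c ∈ K, c ∈ V := fun c hc => hKV hc
  have hKE : K ≤ E := fun c hc => Subfield.subset_closure (Or.inl hc)
  have hEF : E ≤ F := Subfield.closure_le.mpr (by
    rintro w (hw | ⟨i, rfl⟩ | ⟨j, rfl⟩)
    exacts [hKF hw, (hxF i).1, hyF j])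
  have hηF : η ∈ F := by
    rw [← hEηF]
    exact Subfield.subset_closure (Or.inr rfl)
  -- representations of the elements of `Z`
  have hrepZ : ∀ z : Z, ∃ (a b : Polynomial Ω) (k : ℕ),
      (∀ P ∈ ({a, b} : Set (Polynomial Ω)), ∀ k, P.coeff k ∈ V ∧ P.coeff k ∈ E) ∧
      V.valuation (b.eval η) = 1 ∧ (z : Ω) = a.eval η / (b.eval η * g.eval η ^ k) :=
    fun z => hOF z (hZ z z.2).2 (hZ z z.2).1
  choose az bz kz hcz hvbz hzeq using hrepZ
  -- the finite set `Z''` of coefficients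
  let Z'' : Finset Ω := (f.coeffs ∪ g.coeffs ∪ h.coeffs ∪ p₂.coeffs) ∪
    Finset.univ.biUnion fun z : Z => (az z).coeffs ∪ (bz z).coeffs
  have hcoeffs : ∀ P : Polynomial Ω, (∀ k, P.coeff k ∈ V ∧ P.coeff k ∈ E) →
      ∀ w ∈ P.coeffs, w ∈ V ∧ w ∈ E := by
    intro P hP w hw
    obtain ⟨k, -, rfl⟩ := Polynomial.mem_coeffs_iff.mp hw
    exact hP k
  have hfZ : f.coeffs ⊆ Z'' := fun w hw => by simp [Z'', hw]
  have hgZ : g.coeffs ⊆ Z'' := fun w hw => by simp [Z'', hw]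
  have hhZ : h.coeffs ⊆ Z'' := fun w hw => by simp [Z'', hw]
  have hp₂Z : p₂.coeffs ⊆ Z'' := fun w hw => by simp [Z'', hw]
  have haZ : ∀ z : Z, (az z).coeffs ⊆ Z'' := fun z w hw => by
    simp only [Z'', Finset.mem_union, Finset.mem_biUnion, Finset.mem_univ, true_and]
    exact Or.inr ⟨z, Or.inl hw⟩
  have hbZ : ∀ z : Z, (bz z).coeffs ⊆ Z'' := fun z w hw => by
    simp only [Z'', Finset.mem_union, Finset.mem_biUnion, Finset.mem_univ, true_and]
    exact Or.inr ⟨z, Or.inr hw⟩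
  have hZ'' : ∀ w ∈ Z'', w ∈ V ∧ w ∈ E := by
    intro w hw
    simp only [Z'', Finset.mem_union, Finset.mem_biUnion, Finset.mem_univ, true_and] at hw
    rcases hw with (((hw | hw) | hw) | hw) | ⟨z, hw | hw⟩
    · exact hcoeffs f (hcoef f (by simp)) w hw
    · exact hcoeffs g (hcoef g (by simp)) w hw
    · exact hcoeffs h (hcoef h (by simp)) w hw
    · exact hcoeffs p₂ (hcoef p₂ (by simp)) w hw
    · exact hcoeffs _ (hcz z _ (by simp)) w hw
    · exact hcoeffs _ (hcz z _ (by simp)) w hw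
  -- Thm. 4.1 for `E` and `Z''`: the polynomial ring `A₀ = K[x', y]`
  obtain ⟨x', hx', hxx', -, hind, hZ''A⟩ :=
    knafKuhlmann2005_thm41_field V K hKV' x y hx0 hxi hy hri Z'' hZ''
  set A₀ : Subalgebra K Ω := Algebra.adjoin K (Set.range x' ∪ Set.range y) with hA₀
  let VK : Subalgebra K Ω := { V.toSubring with algebraMap_mem' := fun c => hKV' c c.2 }
  have hA₀V' : A₀ ≤ VK := by
    refine Algebra.adjoin_le ?_
    rintro w (⟨j, rfl⟩ | ⟨j, rfl⟩)
    · exact (V.valuation_le_one_iff _).mp (hx' j).2.2.le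
    · exact hy j
  have hA₀V : A₀.toSubring ≤ V.toSubring := fun w hw => hA₀V' hw
  let EK : Subalgebra K Ω := { E.toSubring with algebraMap_mem' := fun c => hKE c.2 }
  have hA₀E' : A₀ ≤ EK := by
    refine Algebra.adjoin_le ?_
    rintro w (⟨j, rfl⟩ | ⟨j, rfl⟩)
    · exact (hx' j).1
    · exact Subfield.subset_closure (Or.inr (Or.inr ⟨j, rfl⟩))
  have hA₀E : (A₀ : Set Ω) ⊆ E := fun w hw => hA₀E' hw
  have hrange : Set.range (Sum.elim x' y) = Set.range x' ∪ Set.range y := Set.Sum.elim_range _ _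
  let e₀ : MvPolynomial (Fin ρ ⊕ Fin τ) K ≃ₐ[K] A₀ :=
    hind.aevalEquiv.trans (Subalgebra.equivOfEq _ _ (by rw [hA₀, ← hrange]))
  haveI : Algebra.FinitePresentation K A₀ := Algebra.FinitePresentation.equiv e₀
  haveI : Algebra.FormallySmooth K A₀ := Algebra.FormallySmooth.of_equiv e₀
  haveI : IsIntegrallyClosed A₀ := by
    haveI : UniqueFactorizationMonoid A₀ :=
      (e₀.toMulEquiv).uniqueFactorizationMonoid inferInstance
    infer_instance
  -- `B := A₀[1/d] ∋ Z''`
  obtain ⟨B, hA₀B, hBV, hBE, hZ''B, hBsm, hBic⟩ :=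
    exists_smooth_normal_locAway V A₀ hA₀V hA₀E Z'' hZ''A
  haveI := hBsm
  haveI := hBic
  have hBF : (B : Set Ω) ⊆ F := fun w hw => hEF (hBE hw)
  have hinj : Function.Injective (algebraMap B Ω) := Subtype.val_injective
  -- the polynomials over `B`
  have hcoefB : ∀ P : Polynomial Ω, P.coeffs ⊆ Z'' → ∀ k, P.coeff k ∈ B := by
    intro P hP k
    by_cases h0 : P.coeff k = 0
    · rw [h0]; exact B.zero_mem
    · exact hZ''B _ (hP (Polynomial.coeff_mem_coeffs h0))
  obtain ⟨fB, hfB, hfBmon'⟩ := exists_map_eq_of_coeff_mem B f (hcoefB f hfZ)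
  have hfBmon : fB.Monic := hfBmon' hfmon
  obtain ⟨gB, hgB, -⟩ := exists_map_eq_of_coeff_mem B g (hcoefB g hgZ)
  obtain ⟨hB, hhB, -⟩ := exists_map_eq_of_coeff_mem B h (hcoefB h hhZ)
  obtain ⟨p₂B, hp₂B, -⟩ := exists_map_eq_of_coeff_mem B p₂ (hcoefB p₂ hp₂Z)
  have hidentB : Polynomial.derivative fB * hB + fB * p₂B = gB ^ s := by
    apply Polynomial.map_injective (algebraMap B Ω) hinj
    simp only [Polynomial.map_mul, Polynomial.map_add, Polynomial.map_pow,
      ← Polynomial.derivative_map, hfB, hgB, hhB, hp₂B]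
    exact hident
  have hfBη : Polynomial.aeval η fB = 0 := by rw [aeval_eq_eval_map, hfB]; exact hfη
  have hgBη : Polynomial.aeval η gB = g.eval η := by rw [aeval_eq_eval_map, hgB]
  have hvgB : V.valuation (Polynomial.aeval η gB) = 1 := by rw [hgBη]; exact hvg
  have hfBmin : ∀ q : Polynomial B, q ≠ 0 → Polynomial.aeval η q = 0 →
      fB.natDegree ≤ q.natDegree := by
    intro q hq0 hq'
    have hqE : ∀ k, (q.map (algebraMap B Ω)).coeff k ∈ E := fun k => by
      rw [Polynomial.coeff_map]
      exact hBE (q.coeff k).2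
    have hq'0 : q.map (algebraMap B Ω) ≠ 0 := (Polynomial.map_ne_zero_iff hinj).mpr hq0
    have hev : (q.map (algebraMap B Ω)).eval η = 0 := by rw [← aeval_eq_eval_map]; exact hq'
    have h1 := hfmin _ hqE hq'0 hev
    rwa [Polynomial.natDegree_map_eq_of_injective hinj, ← hfB,
      Polynomial.natDegree_map_eq_of_injective hinj] at h1
  -- the standard-étale model
  obtain ⟨A, hAV, hAF, hfpA, hsmA, hpolyA⟩ := exists_standardEtale_model V B hBV hBF hηV hηF
    fB gB hB p₂B s hfBmon hfBη hfBmin hidentB hvgB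
  have hBA : ∀ b : Ω, b ∈ B → b ∈ A := fun b hb => by
    have := hpolyA (Polynomial.C ⟨b, hb⟩)
    rwa [Polynomial.aeval_C] at this
  have hηA : η ∈ A := by
    have := hpolyA Polynomial.X
    rwa [Polynomial.aeval_X] at this
  refine ⟨A, hAV, hAF, hfpA, fun w hw => ?_, hsmA, fun z hz => ?_⟩
  · -- `Frac A = F`
    have hKA : ∀ u ∈ K, u ∈ A := fun u hu => hBA u (hA₀B (A₀.algebraMap_mem ⟨u, hu⟩))
    have hwc : w ∈ Subfield.closure (A : Set Ω) := by
      rw [← hEηF] at hw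
      refine (Subfield.closure_le.mpr ?_) hw
      rintro u (hu | rfl)
      · refine (Subfield.closure_le.mpr ?_) hu
        rintro u (hu | ⟨i, rfl⟩ | ⟨j, rfl⟩)
        · exact Subfield.subset_closure (hKA u hu)
        · refine (Subfield.closure_le.mpr ?_) (hxx' i)
          rintro u (hu | ⟨j, rfl⟩)
          · exact Subfield.subset_closure (hKA u hu)
          · exact Subfield.subset_closure
              (hBA _ (hA₀B (Algebra.subset_adjoin (Or.inl ⟨j, rfl⟩))))
        · exact Subfield.subset_closure
            (hBA _ (hA₀B (Algebra.subset_adjoin (Or.inr ⟨j, rfl⟩))))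
      · exact Subfield.subset_closure hηA
    obtain ⟨a, ha, b, hb, rfl⟩ := Subfield.mem_closure_iff.mp hwc
    have hcl : Subring.closure (A : Set Ω) = A.toSubring := Subring.closure_eq A.toSubring
    rw [hcl] at ha hb
    exact ⟨a, ha, b, hb, rfl⟩
  · -- `Z ⊆ A_q`
    set ζ : Z := ⟨z, hz⟩ with hζ
    obtain ⟨aB, haB, -⟩ := exists_map_eq_of_coeff_mem B (az ζ) (hcoefB _ (haZ ζ))
    obtain ⟨bB, hbB, -⟩ := exists_map_eq_of_coeff_mem B (bz ζ) (hcoefB _ (hbZ ζ))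
    refine ⟨(az ζ).eval η, ?_, (bz ζ).eval η * g.eval η ^ (kz ζ), ?_, ?_, hzeq ζ⟩
    · rw [← haB, ← aeval_eq_eval_map]
      exact hpolyA aB
    · refine mul_mem ?_ (pow_mem ?_ _)
      · rw [← hbB, ← aeval_eq_eval_map]
        exact hpolyA bB
      · rw [← hgBη]
        exact hpolyA gB
    · rw [map_mul, map_pow, hvbz, hvg, one_pow, one_mul]

/-- **Knaf–Kuhlmann 2009, Thm. 1.2 (type-level rendering) from KK09 Thm. 1.1 and KK05 Thm. 3.4.**
[cite: KnafKuhlmann2009, Thm. 1.2 and §4.2] -/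
theorem KnafKuhlmann2009_Thm12.of_parts'' (h11 : KnafKuhlmann2009_Thm11.{u})
    (h34 : KnafKuhlmann2005_Thm34_etale.{u}) : KnafKuhlmann2009_Thm12.{u} :=
  KnafKuhlmann2009_Thm12.of_parts' h11 (KnafKuhlmann2005_Thm11.of_parts h34)

/-- **The fact `KnafKuhlmann2009` from KK09 Thm. 1.1 and KK05 Thm. 3.4**: all other ingredients of
the printed proofs of Knaf–Kuhlmann 2009, Thm. 1.2 and Knaf–Kuhlmann 2005, Thm. 1.1 are proved
in this topic (Lemma 4.2 in `PerronTransforms.lean`). [cite: KnafKuhlmann2009, Thm. 1.2] -/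
theorem KnafKuhlmann2009.of_parts'' (h11 : KnafKuhlmann2009_Thm11.{u})
    (h34 : KnafKuhlmann2005_Thm34_etale.{u}) : KnafKuhlmann2009.{u} :=
  KnafKuhlmann2009.of_parts' h11 (KnafKuhlmann2005_Thm11.of_parts h34)

end EtaleAscent

end Literature.AlgebraicGeometry.Resolution

end
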